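import Literature.NumberTheory.GaloisRepresentations.LubinTateColemanCoordFreeTwo
import Literature.NumberTheory.GaloisRepresentations.PowerSeriesCoeffAdicComplete
import HarnessLib

/-!
# Base change of the Lubin–Tate twist: `S⟦Y⟧` is FREE OF RANK TWO over `S⟦T⟧` for every `(π)`-complete `𝒪_F`-algebra `S` — in particular
# the two-variable coordinate module `𝒪_F⟦X⟧⟦Y⟧` over the two-variable Iwasawa algebra `𝒪_F⟦X⟧⟦T⟧` (`X = φ − 1`, `T = σ_γ − 1`), basis `{1, Y}`
# (de Shalit I §3.1, §3.7–3.8 (17), III §1.3 — the `Λ₂`-structure, Lubin–Tate direction)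

De Shalit, *Iwasawa theory of elliptic curves with complex multiplication* (1987), Ch. I §3.7–3.8 and Ch. III §1.3: the semi-local units of
the two-variable tower are, through the two-variable Coleman map, a module over the two-variable Iwasawa algebra.  In the tree's series
currency (`q = 2`, `π = 2u`, `f = πX + X²`) the norm-coherent units of `⋃_m E_m·K_π^∞` embed into `𝒪_F⟦X⟧⟦Y⟧ = PowerSeries (PowerSeries 𝒪_F)`
with cyclic cokernel (`LubinTateColemanTwoVariableTransformTwo`, `…CokernelTwo`), the unramified Frobenius acting on the inner variable as
`·(1 + X)`.  The Lubin–Tate direction acts on the outer (Coleman) variable `Y` through the one-variable twist `D_γ r = γ·ρ_γ·(r ∘ [γ]_f) − r`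
(`LubinTateColemanCoordIwasawaActionTwo`), whose ingredients `ρ_γ, [γ]_f` have `𝒪_F`-coefficients; so it base-changes along ANY ring map
`ι : 𝒪_F → S` to an `S`-linear operator on `S⟦Y⟧`.  This file proves, for every commutative `S` that is `(ι π)`-adically complete with `ι π`
a non-zero-divisor (e.g. `S = 𝒪_F⟦X⟧`, `ι = C`, by `PowerSeriesCoeffAdicComplete`):

* `twistLinearBase ι` — `D_γ^{S} r = C(ιγ)·ρ_γ^{ι}·(r ∘ [γ]^{ι}) − r`; `twistLinearBase_apply`; ★ `twistLinearBase_map` (**`D_γ^{S}(map ι r) = map ι (D_γ r)`**);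
* ★ `twistLinearBase_mem_adicFiltGen_succ` — topological nilpotence for the `(ι π, Y)`-adic filtration; ★ `twistLinearBase_X_pow_sub_mem_degFilt`
  — `D_γ^{S}(Y^k) ≡ Y^{k+2} (mod ι π, Y^{k+3})` (`γ = 1 + π²w`, `w` a unit; from `twistLinear_X_pow_sub_mem_degFilt`);
* ★★★ `existsUnique_tAct_twistLinearBase` — **every `G ∈ S⟦Y⟧` is UNIQUELY `a·1 + b·Y`, `a, b ∈ S⟦T⟧`** (`PowerSeriesTopNilpotentBasisFree`);
* ★★★ `existsUnique_tAct_twistLinearBase_C` — the case `S = 𝒪_F⟦X⟧`: **`𝒪_F⟦X⟧⟦Y⟧ = Λ·1 ⊕ Λ·Y` is free of rank two over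
  `Λ = 𝒪_F⟦X⟧⟦T⟧ = Λ(ℤ_p × Γ')`**, the two-variable Iwasawa algebra in `X = φ − 1` and `T = σ_γ − 1` (`Γ' = γ^{ℤ₂}` of index `2` in `𝒪_F^×`);
  `tAct_twistLinearBase_C_mul` — the `T`-action is `S`-linear (the two variables commute).

Everything PROVED (0 sorry, no named facts); one transparent definition (`twistLinearBase`).  Not yet here: the identification of
`1 + D_γ^{𝒪⟦X⟧}` with `σ_γ` on the two-variable Coleman transform `Col(β)` (levelwise `relUnitCoordTwo_galAct…`, and the transform is
`𝒪_F`-linear coefficientwise) — the equivariance statement the (e)-assembler consumes.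

## References

* E. de Shalit, *Iwasawa theory of elliptic curves with complex multiplication* (1987), Ch. I §3.1, §3.4 Lemma (ii), §3.7–3.8 (17); Ch. III §1.3. [deShalit1987]
* L. C. Washington, *Introduction to Cyclotomic Fields*, 2nd ed. (1997), §7.1, §13.2. [Washington1997]
-/

noncomputable section

open scoped PowerSeries.WithPiTopology

namespace Literature.NumberTheory.GaloisRepresentations

section CoordFreeTwoVariable

open GaloisRepresentations.IsNonarchimedeanLocalField LubinTate ValuativeRel Finset

/-- A ring map carries `(a)` into `(ι a)`. [cite: Washington1997, §7.1] -/
theorem LubinTate.map_mem_span_singleton_of_mem {R S : Type*} [CommRing R] [CommRing S] (ι : R →+* S) {a x : R}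
    (hx : x ∈ Ideal.span {a}) : ι x ∈ Ideal.span {ι a} := by
  obtain ⟨y, hy⟩ := Ideal.mem_span_singleton'.mp hx
  exact Ideal.mem_span_singleton'.mpr ⟨ι y, by rw [← map_mul, hy]⟩

variable {F : Type} [Field F] [ValuativeRel F] [TopologicalSpace F] [IsNonarchimedeanLocalField F]

attribute [local instance] ltNormUniformSpace ltNormIsUniformAddGroup rk1 nF nE fintypeResidueField

variable {π : 𝒪[F]} (hπ : (valuation F).IsUniformizer (π : F)) (hq : residueFieldCard F = 2)
variable {S : Type*} [CommRing S] (ι : LTCoeff F →+* S)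

/-! ### The Lubin–Tate twist over an `𝒪_F`-algebra `S` -/

/-- `[γ]_f` pushed to `S⟦Y⟧` has no constant term. [cite: deShalit1987, Ch. I §3.4 Lemma (ii)] -/
theorem constantCoeff_map_unitHom (γ : 𝒪[F]ˣ) :
    PowerSeries.constantCoeff (PowerSeries.map ι
      (hom (isLTRing_LTCoeff hπ) (isLTSeries_LTCoeff π) (isLTSeries_LTCoeff π) (LTCoeff.of F (γ : 𝒪[F])))) = 0 := by
  rw [← PowerSeries.coeff_zero_eq_constantCoeff, PowerSeries.coeff_map, PowerSeries.coeff_zero_eq_constantCoeff, constantCoeff_hom, map_zero]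

/-- **`D_γ^{S} r := C(ιγ)·(map ι ρ_γ)·(r ∘ map ι [γ]_f) − r`** on `S⟦Y⟧`: the base change along `ι : 𝒪_F → S` of the one-variable twist
`D_γ = σ_γ − 1` (`twistLinear`), an `S`-linear operator. [cite: deShalit1987, Ch. I §3.4 Lemma (ii), §3.8 (17)] -/
def twistLinearBase (u : (LTCoeff F)ˣ) (γ : 𝒪[F]ˣ) : PowerSeries S →ₗ[S] PowerSeries S :=
  LinearMap.mulLeft S (PowerSeries.C (ι (LTCoeff.of F (γ : 𝒪[F]))) *
      PowerSeries.map ι (evenPartTwo hπ hq (unitTwistSerTwo hπ (↑u⁻¹ : LTCoeff F) γ))) ∘ₗ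
    (PowerSeries.substAlgHom (PowerSeries.HasSubst.of_constantCoeff_zero' (constantCoeff_map_unitHom hπ ι γ))).toLinearMap - LinearMap.id

/-- Unfolding `twistLinearBase`. [cite: deShalit1987, Ch. I §3.4 Lemma (ii)] -/
theorem twistLinearBase_apply (u : (LTCoeff F)ˣ) (γ : 𝒪[F]ˣ) (r : PowerSeries S) :
    twistLinearBase hπ hq ι u γ r = PowerSeries.C (ι (LTCoeff.of F (γ : 𝒪[F]))) *
      PowerSeries.map ι (evenPartTwo hπ hq (unitTwistSerTwo hπ (↑u⁻¹ : LTCoeff F) γ)) *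
      PowerSeries.subst (PowerSeries.map ι
        (hom (isLTRing_LTCoeff hπ) (isLTSeries_LTCoeff π) (isLTSeries_LTCoeff π) (LTCoeff.of F (γ : 𝒪[F])))) r - r := by
  rw [twistLinearBase, LinearMap.sub_apply, LinearMap.comp_apply, LinearMap.id_apply, AlgHom.toLinearMap_apply, PowerSeries.coe_substAlgHom,
    LinearMap.mulLeft_apply]

/-- ★ **`D_γ^{S}(map ι r) = map ι (D_γ r)`**: on series coming from `𝒪_F⟦Y⟧` the base-changed twist is the one-variable twist.
[cite: deShalit1987, Ch. I §3.4 Lemma (ii)] -/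
theorem twistLinearBase_map (u : (LTCoeff F)ˣ) (γ : 𝒪[F]ˣ) (r : PowerSeries (LTCoeff F)) :
    twistLinearBase hπ hq ι u γ (PowerSeries.map ι r) = PowerSeries.map ι (twistLinear hπ hq u γ r) := by
  rw [twistLinearBase_apply, twistLinear_apply]
  set H := hom (isLTRing_LTCoeff hπ) (isLTSeries_LTCoeff π) (isLTSeries_LTCoeff π) (LTCoeff.of F (γ : 𝒪[F])) with hH
  have hs : PowerSeries.HasSubst H := PowerSeries.HasSubst.of_constantCoeff_zero' (by rw [hH]; exact constantCoeff_hom _ _ _ _)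
  have e : PowerSeries.map ι (PowerSeries.subst H r) = PowerSeries.subst (PowerSeries.map ι H) (PowerSeries.map ι r) :=
    PowerSeries.map_subst hs r
  rw [map_sub, map_mul, map_mul, PowerSeries.map_C, e]

/-- `D_γ^{S}(Y^k) = map ι (D_γ(Y^k))`. [cite: deShalit1987, Ch. I §3.4 Lemma (ii)] -/
theorem twistLinearBase_X_pow (u : (LTCoeff F)ˣ) (γ : 𝒪[F]ˣ) (k : ℕ) :
    twistLinearBase hπ hq ι u γ (PowerSeries.X ^ k) = PowerSeries.map ι (twistLinear hπ hq u γ (PowerSeries.X ^ k)) := by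
  have e : PowerSeries.map ι (PowerSeries.X ^ k : PowerSeries (LTCoeff F)) = PowerSeries.X ^ k := by rw [map_pow, PowerSeries.map_X]
  rw [← twistLinearBase_map, e]

/-! ### Topological nilpotence and triangularity over `S` -/

/-- ★ **`D_γ^{S}` is topologically nilpotent**: `D_γ^{S}(I_N) ⊆ I_{N+1}` for the `(ι π, Y)`-adic filtration `I_N = adicFiltGen (ι π) N` of `S⟦Y⟧`
(`D r = (Cγ·ρ − 1)(r ∘ [γ]) + (r ∘ [γ] − r)`, `[γ] = γY + …`, `γ ≡ 1`, `ρ(0) = 1`; `q = 2`). [cite: deShalit1987, Ch. I §3.1, §3.4 Lemma (ii)] -/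
theorem twistLinearBase_mem_adicFiltGen_succ (u : (LTCoeff F)ˣ) (hu : LTCoeff.of F π = residueFieldCard F * u) (γ : 𝒪[F]ˣ) (N : ℕ)
    (r : PowerSeries S) (hr : r ∈ adicFiltGen (ι (LTCoeff.of F π)) N) :
    twistLinearBase hπ hq ι u γ r ∈ adicFiltGen (ι (LTCoeff.of F π)) (N + 1) := by
  have ht := two_eq_of_mul_inv hq u hu
  set H := PowerSeries.map ι (hom (isLTRing_LTCoeff hπ) (isLTSeries_LTCoeff π) (isLTSeries_LTCoeff π) (LTCoeff.of F (γ : 𝒪[F]))) with hH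
  set ρ := PowerSeries.map ι (evenPartTwo hπ hq (unitTwistSerTwo hπ (↑u⁻¹ : LTCoeff F) γ)) with hρ
  have hH0 : PowerSeries.constantCoeff H = 0 := constantCoeff_map_unitHom hπ ι γ
  have hH1 : PowerSeries.coeff 1 H - 1 ∈ Ideal.span {ι (LTCoeff.of F π)} := by
    rw [hH, PowerSeries.coeff_map, coeff_one_hom, ← map_one ι, ← map_sub]
    exact map_mem_span_singleton_of_mem ι (sub_one_mem_span_pi_of_isUnit_two hπ hq γ)
  have hρ1 : PowerSeries.C (ι (LTCoeff.of F (γ : 𝒪[F]))) * ρ - 1 ∈ adicFiltGen (ι (LTCoeff.of F π)) 1 := by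
    refine mem_adicFiltGen_one_of_constantCoeff_mem ?_
    rw [map_sub, map_one, map_mul, PowerSeries.constantCoeff_C, hρ, ← PowerSeries.coeff_zero_eq_constantCoeff, PowerSeries.coeff_map,
      PowerSeries.coeff_zero_eq_constantCoeff, constantCoeff_evenPartTwo_unitTwistSerTwo hπ hq ht, map_one, mul_one, ← map_one ι, ← map_sub]
    exact map_mem_span_singleton_of_mem ι (sub_one_mem_span_pi_of_isUnit_two hπ hq γ)
  rw [twistLinearBase_apply, ← hH, ← hρ]
  have e : PowerSeries.C (ι (LTCoeff.of F (γ : 𝒪[F]))) * ρ * PowerSeries.subst H r - r =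
      (PowerSeries.C (ι (LTCoeff.of F (γ : 𝒪[F]))) * ρ - 1) * PowerSeries.subst H r + (PowerSeries.subst H r - r) := by ring
  rw [e]
  refine add_mem ?_ (subst_sub_self_mem_adicFiltGen_succ hH0 hH1 N hr)
  have h := mul_mem_adicFiltGen hρ1 (subst_mem_adicFiltGen_of_mem hH0 hH1 N hr)
  rwa [Nat.add_comm] at h

/-- ★ **`D_γ^{S}(Y^k) ≡ Y^{k+2} (mod ι π, Y^{k+3})`** for `γ = 1 + π²w`, `w` a unit (the one-variable congruence pushed along `ι`).
[cite: deShalit1987, Ch. I §3.1, §3.4 Lemma (ii)] -/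
theorem twistLinearBase_X_pow_sub_mem_degFilt (u : (LTCoeff F)ˣ) (hu : LTCoeff.of F π = residueFieldCard F * u) (γ w : 𝒪[F]ˣ)
    (hγ : (γ : 𝒪[F]) = 1 + π ^ 2 * w) (k : ℕ) :
    twistLinearBase hπ hq ι u γ (PowerSeries.X ^ k) - PowerSeries.X ^ (k + 2) ∈ degFilt (ι (LTCoeff.of F π)) (k + 2 + 1) := by
  have h := twistLinear_X_pow_sub_mem_degFilt hπ hq u hu γ w hγ k
  rw [twistLinearBase_X_pow, ← PowerSeries.map_X (f := ι), ← map_pow, ← map_sub]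
  intro i hi
  rw [PowerSeries.coeff_map]
  exact map_mem_span_singleton_of_mem ι (h i hi)

/-! ### Freeness of rank two over `S⟦T⟧` -/

/-- ★★★ **`S⟦Y⟧` is free of rank two over `S⟦T⟧` with basis `{1, Y}`** for the base-changed twist: if `S` is `(ι π)`-adically complete and
`ι π` is a non-zero-divisor of `S`, then for `γ = 1 + π²w` (`w` a unit, `q = 2`, `π = 2u`) every `G ∈ S⟦Y⟧` is UNIQUELY `a·1 + b·Y` with
`a, b ∈ S⟦T⟧` acting by `c(T)·G = Σ_k c_k (D_γ^{S})^k G`. [cite: deShalit1987, Ch. I §3.1, §3.8 (17); Ch. III §1.3] -/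
theorem existsUnique_tAct_twistLinearBase [IsAdicComplete (Ideal.span {ι (LTCoeff.of F π)}) S]
    (hreg : ∀ x : S, ι (LTCoeff.of F π) * x = 0 → x = 0) (u : (LTCoeff F)ˣ) (hu : LTCoeff.of F π = residueFieldCard F * u) (γ w : 𝒪[F]ˣ)
    (hγ : (γ : 𝒪[F]) = 1 + π ^ 2 * w) (G : PowerSeries S) :
    ∃! ab : PowerSeries S × PowerSeries S,
      tAct (twistLinearBase hπ hq ι u γ) (twistLinearBase_mem_adicFiltGen_succ hπ hq ι u hu γ) ab.1 1 +
        tAct (twistLinearBase hπ hq ι u γ) (twistLinearBase_mem_adicFiltGen_succ hπ hq ι u hu γ) ab.2 PowerSeries.X = G :=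
  existsUnique_tAct_one_add_tAct_X (twistLinearBase_mem_adicFiltGen_succ hπ hq ι u hu γ) hreg
    (twistLinearBase_X_pow_sub_mem_degFilt hπ hq ι u hu γ w hγ) G

/-! ### The two-variable coordinate module `𝒪_F⟦X⟧⟦Y⟧` over `𝒪_F⟦X⟧⟦T⟧` -/

include hπ in
/-- `𝒪_F⟦X⟧` is `(C π)`-adically complete. [cite: Washington1997, §7.1] -/
theorem isAdicComplete_span_C_LTCoeff :
    IsAdicComplete (Ideal.span {PowerSeries.C (LTCoeff.of F π)}) (PowerSeries (LTCoeff F)) :=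
  haveI := isAdicComplete_LTCoeff hπ
  isAdicComplete_span_C

include hπ in
/-- `C π` is a non-zero-divisor of `𝒪_F⟦X⟧`. [cite: Washington1997, §7.1] -/
theorem eq_zero_of_C_pi_mul_eq_zero (x : PowerSeries (LTCoeff F)) (h : PowerSeries.C (LTCoeff.of F π) * x = 0) : x = 0 := by
  ext i
  have hi := congrArg (PowerSeries.coeff i) h
  rw [PowerSeries.coeff_C_mul, map_zero] at hi
  rw [map_zero]
  exact (isLTRing_LTCoeff hπ).eq_zero_of_mul_eq_zero _ hi

/-- ★★★ **The two-variable coordinate module `𝒪_F⟦X⟧⟦Y⟧` is free of rank two over `𝒪_F⟦X⟧⟦T⟧` with basis `{1, Y}`** (`S = 𝒪_F⟦X⟧`,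
`ι = C`): for `γ = 1 + π²w` (`w` a unit, `q = 2`, `π = 2u`), every `G ∈ 𝒪_F⟦X⟧⟦Y⟧ = PowerSeries (PowerSeries 𝒪_F)` is UNIQUELY `a·1 + b·Y`
with `a, b ∈ 𝒪_F⟦X⟧⟦T⟧` — `𝒪_F⟦X⟧⟦Y⟧ ≅ Λ·1 ⊕ Λ·Y`, `Λ = 𝒪_F⟦X⟧⟦T⟧ = Λ(ℤ_p × Γ')`, the two-variable Iwasawa algebra in `X = φ − 1`
(unramified, acting on coefficients) and `T = σ_γ − 1` (Lubin–Tate, acting through `D_γ^{𝒪⟦X⟧}`). [cite: deShalit1987, Ch. I §3.1, §3.8 (17); Ch. III §1.3] -/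
theorem existsUnique_tAct_twistLinearBase_C (u : (LTCoeff F)ˣ) (hu : LTCoeff.of F π = residueFieldCard F * u) (γ w : 𝒪[F]ˣ)
    (hγ : (γ : 𝒪[F]) = 1 + π ^ 2 * w) (G : PowerSeries (PowerSeries (LTCoeff F))) :
    haveI := isAdicComplete_span_C_LTCoeff hπ
    ∃! ab : PowerSeries (PowerSeries (LTCoeff F)) × PowerSeries (PowerSeries (LTCoeff F)),
      tAct (twistLinearBase hπ hq (PowerSeries.C (R := LTCoeff F)) u γ)
          (twistLinearBase_mem_adicFiltGen_succ hπ hq (PowerSeries.C (R := LTCoeff F)) u hu γ) ab.1 1 +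
        tAct (twistLinearBase hπ hq (PowerSeries.C (R := LTCoeff F)) u γ)
          (twistLinearBase_mem_adicFiltGen_succ hπ hq (PowerSeries.C (R := LTCoeff F)) u hu γ) ab.2 PowerSeries.X = G := by
  haveI := isAdicComplete_span_C_LTCoeff hπ
  exact existsUnique_tAct_twistLinearBase hπ hq PowerSeries.C (eq_zero_of_C_pi_mul_eq_zero hπ) u hu γ w hγ G

/-- ★ **The `T`-action is `S`-linear**: `c·(C s · G) = C s · (c·G)` for `s ∈ S` — for `S = 𝒪_F⟦X⟧` the inner variable `X = φ − 1` and the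
outer action `T = σ_γ − 1` commute, so `tAct` is a module structure over the two-variable algebra `𝒪_F⟦X⟧⟦T⟧`. [cite: deShalit1987, Ch. I §3.8 (17)] -/
theorem tAct_twistLinearBase_C_mul [IsAdicComplete (Ideal.span {ι (LTCoeff.of F π)}) S] (u : (LTCoeff F)ˣ)
    (hu : LTCoeff.of F π = residueFieldCard F * u) (γ : 𝒪[F]ˣ) (s : S) (c G : PowerSeries S) :
    tAct (twistLinearBase hπ hq ι u γ) (twistLinearBase_mem_adicFiltGen_succ hπ hq ι u hu γ) c (PowerSeries.C s * G) =
      PowerSeries.C s * tAct (twistLinearBase hπ hq ι u γ) (twistLinearBase_mem_adicFiltGen_succ hπ hq ι u hu γ) c G :=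
  tAct_C_mul_right _ s c G

end CoordFreeTwoVariable

end Literature.NumberTheory.GaloisRepresentations
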